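import Mathlib
import Literature.NumberTheory.LFunctions.Zhang2022.TypedSection17Identities
import Literature.NumberTheory.LFunctions.Zhang2022.KappaLSeries
import Literature.NumberTheory.LFunctions.Zhang2022.SmoothWeightSegmentTail
import Literature.NumberTheory.LFunctions.Zhang2022.SmoothWeightDiagonal
import HarnessLib

/-!
# Zhang (2022) §17 p. 96: `Φ₃⁺(p)` per character — `Σ_m ν*(m)ψ(m)m^{−s}` converges absolutely on
# `σ > 1`, the integrand `𝔨₃(s,ψ)ω(s)` on the line `σ = 3/2`, and the term-by-term step with the
# segment→line error explicit

Topic `Literature/NumberTheory/LFunctions/Zhang2022` (Landau–Siegel audit tree; verdict-neutral).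
Y. Zhang, *Discrete mean estimates and the Landau–Siegel zero*, arXiv:2211.02515v1 (2022)
[Zhang2022LandauSiegel] — **an unrefereed manuscript under adjudication** (cell siegel-zhang, D-0069).
§17 p. 96 [tex L4715–4727]: "`Φ₃⁺(p) = Σ*_{ψ (mod p)} (1/2πi)∫_{𝔍(1)} 𝔨₃(s,ψ)ω(s)ds` … For `σ > 1` we
can write `(L(s+β₁,ψ)/L(s,ψ))BGN(s+β₂)N(s+β₃) = Σ_m ν*(m)ψ(m)m^{−s}`. Thus, replacing the segment `𝔍(1)`
by the line `σ = 3/2` and integrating term by term give …" The objects are L4-t6's (`TypedSection17`: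
`kfrak3`, `nuStar`, `nN`, …); `Z22:§17.u004` is t6's theorem `step17_u004_holds`. PROVED here
(UNCONDITIONAL, every modulus `D ≥ 2`, 0 new facts): `LSeriesSummable_nuStar(_psi)` (absolute
convergence of `Σν*(m)m^{−s}`, `Σν*(m)ψ(m)m^{−s}` on `σ > 1`: `κ₂` by `KappaLSeries.LSeriesSummable_kappa₂`,
the other four factors finitely supported — `bcoef_eq_zero_of_le`); `kfrak3_mul_omega_eq` (the
integrand on `σ > 1` is `(Σν*ψ m^{−s})(Σ_{n≤D⁴}νψ̄ n^{s−1})ω(s)`); and `norm_segInt_kfrak3_sub_tsum_le`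
— for ONE character `ψ` of modulus `p`,
`‖(1/2πi)∫_{𝔍(1)}𝔨₃ω ds − Σ_mΣ_{n≤D⁴} ν*(m)ψ(m)m^{−s₀}ν(n)ψ̄(n)n^{s₀−1}e^{−𝓛₂²log²(n/m)}‖
≤ (Σ_m|ν*ψ|m^{−3/2})(Σ_{n≤D⁴}|νψ̄|√n)e^{(1−𝓛₁²)/(4𝓛₂²)}` (from `SmoothWeightMellin` +
`SmoothWeightSegmentTail`). The companion `Section17Phi3plusTermByTerm.lean` sums this over
`Σ*_{ψ (mod p)}` into t6's `term_u005` form (`Z22:§17.u005`) and treats the diagonal/off-diagonal.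
Nothing here bears on Theorems 1–2 of the source or on the cell's verdict.

## References

* Y. Zhang, arXiv:2211.02515v1 (2022), §17 p. 96 (before (17.3)).
  [cite: Zhang2022LandauSiegel, §17 p. 96]
-/
noncomputable section

open Complex Real ComplexConjugate

namespace Literature.NumberTheory.LFunctions.Zhang2022.Phi3TermByTerm

open Literature.NumberTheory.LFunctions.Zhang2022
open Literature.NumberTheory.LFunctions.Zhang2022.Skeleton
open Literature.NumberTheory.LFunctions.Zhang2022.Typed.Section17
open scoped LSeries.notation

variable (c' : ℝ) {D : ℕ} [NeZero D] (χ : DirichletCharacter ℂ D)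

/-! ## Summability of the coefficient series `ν*` at `σ > 1` -/

omit [NeZero D] in
/-- A sequence vanishing from `N` on has an everywhere-summable `L`-series. [folklore] -/
private theorem LSeriesSummable_of_eventually_zero {h : ℕ → ℂ} (N : ℕ) (hN : ∀ n, N ≤ n → h n = 0)
    (s : ℂ) : LSeriesSummable h s := by
  refine summable_of_ne_finset_zero (s := Finset.range N) fun n hn => ?_
  have hn' : N ≤ n := by simpa using hn
  rcases eq_or_ne n 0 with rfl | h0
  · simp [LSeries.term]
  · rw [LSeries.term_of_ne_zero h0, hN n hn', zero_div]

omit [NeZero D] in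
/-- `(f ∗ g)·ψ = (f·ψ) ∗ (g·ψ)` for a completely multiplicative twist `ψ` (here `ψ(n) = ψ(n mod p)`).
[folklore] -/
private theorem convolution_mul_psiFn (x : Chr D) (f g : ℕ → ℂ) :
    (fun n => (f ⍟ g) n * psiFn x n) = (fun n => f n * psiFn x n) ⍟ (fun n => g n * psiFn x n) := by
  funext n
  rw [LSeries.convolution_def, LSeries.convolution_def]
  simp only []
  rw [Finset.sum_mul]
  refine Finset.sum_congr rfl fun q hq => ?_
  have hqn : q.1 * q.2 = n := (Nat.mem_divisorsAntidiagonal.mp hq).1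
  rw [← hqn, psiFn]
  push_cast
  rw [map_mul]
  simp only [psiFn]
  ring

omit [NeZero D] in
/-- If `f` vanishes from `A` on and `g` from `B` on, then `f ∗ g` vanishes from `A·B` on. [folklore] -/
private theorem convolution_eq_zero_of_support {f g : ℕ → ℂ} {A B : ℕ} (hf : ∀ a, A ≤ a → f a = 0)
    (hg : ∀ b, B ≤ b → g b = 0) {n : ℕ} (hn : A * B ≤ n) : (f ⍟ g) n = 0 := by
  rw [LSeries.convolution_def]
  refine Finset.sum_eq_zero fun q hq => ?_
  have hqn : q.1 * q.2 = n := (Nat.mem_divisorsAntidiagonal.mp hq).1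
  by_cases ha : A ≤ q.1
  · rw [hf _ ha, zero_mul]
  · by_cases hb : B ≤ q.2
    · rw [hg _ hb, mul_zero]
    · exfalso
      have h1 : q.1 < A := not_le.mp ha
      have h2 : q.2 < B := not_le.mp hb
      have : q.1 * q.2 < A * B := Nat.mul_lt_mul'' h1 h2
      omega

omit [NeZero D] in
/-- **`b(n) = 0` for `n ≥ ⌈max(P₁,P₂)⌉·⌈max(P₃,P₂)⌉`** (the factors of `b = (ϰ₁[<P^{1/2}] + ι₂ϰ₂) ∗
(ῑ₃ϰ₃ + ῑ₄ϰ₂)` vanish beyond `max(P₁,P₂)`, `max(P₃,P₂)`; cf. (15.2) "`b(n) = 0` if `n > PT⁻²η₊`").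
[cite: Zhang2022LandauSiegel, §15 (15.2) p.79] -/
theorem bcoef_eq_zero_of_le {n : ℕ}
    (hn : ⌈max (Skeleton.P1 D) (Skeleton.P2 D)⌉₊ * ⌈max (Skeleton.P3 D) (Skeleton.P2 D)⌉₊ ≤ n) : bcoef D n = 0 := by
  have e := congrFun (bcoef_eq_conv D) n
  rw [e]
  refine convolution_eq_zero_of_support (fun a ha => bA1_eq_zero ?_) (fun b hb => bA2_eq_zero ?_) hn
  · exact le_trans (Nat.le_ceil _) (by exact_mod_cast ha)
  · exact le_trans (Nat.le_ceil _) (by exact_mod_cast hb)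

omit [NeZero D] in
/-- **`Σ_m ν*(m)m^{−s}` converges absolutely for `σ > 1`** (`ν*` = t6's `nuStar`: `κ₂` has an
absolutely convergent `L`-series there, `KappaLSeries.LSeriesSummable_kappa₂`; the other four factors
`b·χ`, `υ·[≤D⁴]`, `nN β₂`, `nN β₃` are finitely supported). [cite: Zhang2022LandauSiegel, §17 p. 96] -/
theorem LSeriesSummable_nuStar {s : ℂ} (hs : 1 < s.re) : LSeriesSummable (nuStar c' χ) s := by
  have h1 : LSeriesSummable (fun n => MeanSquareMajorant.kappa₂ (b1 c' D) n) s :=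
    MeanSquareMajorant.LSeriesSummable_kappa₂ (b1 c' D) hs
  have h2 : LSeriesSummable (fun n => bcoef D n * χ (n : ZMod D)) s :=
    LSeriesSummable_of_eventually_zero _ (fun n hn => by rw [bcoef_eq_zero_of_le hn, zero_mul]) s
  have h3 : LSeriesSummable (trunc (D ^ 4) (ups χ)) s := by
    refine LSeriesSummable_of_eventually_zero (D ^ 4 + 1) (fun n hn => ?_) s
    have : ¬ n ≤ D ^ 4 := by omega
    simp [trunc, this]
  have h4 : ∀ β : ℂ, LSeriesSummable (nN D β) s := fun β =>
    LSeriesSummable_of_eventually_zero ⌈2 * bigT D ^ 2⌉₊ (fun n hn =>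
      nN_eq_zero_of_le D β (le_trans (Nat.le_ceil _) (by exact_mod_cast hn))) s
  unfold nuStar
  exact (((h1.convolution h2).convolution h3).convolution (h4 _)).convolution (h4 _)

omit [NeZero D] in
/-- **`Σ_m ν*(m)ψ(m)m^{−s}` converges absolutely for `σ > 1`**, every `ψ ∈ Ψ` (the twist commutes
with Dirichlet convolution). [cite: Zhang2022LandauSiegel, §17 p. 96] -/
theorem LSeriesSummable_nuStar_psi (x : Chr D) {s : ℂ} (hs : 1 < s.re) :
    LSeriesSummable (fun m => nuStar c' χ m * psiFn x m) s := by
  have h1 : LSeriesSummable (fun n => MeanSquareMajorant.kappa₂ (b1 c' D) n * psiFn x n) s :=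
    (LRatio_eq_LSeries x c' s hs).2
  have h2 : LSeriesSummable (fun n => bcoef D n * χ (n : ZMod D) * psiFn x n) s :=
    LSeriesSummable_of_eventually_zero _ (fun n hn => by rw [bcoef_eq_zero_of_le hn]; ring) s
  have h3 : LSeriesSummable (fun n => trunc (D ^ 4) (ups χ) n * psiFn x n) s := by
    refine LSeriesSummable_of_eventually_zero (D ^ 4 + 1) (fun n hn => ?_) s
    have : ¬ n ≤ D ^ 4 := by omega
    simp [trunc, this]
  have h4 : ∀ β : ℂ, LSeriesSummable (fun n => nN D β n * psiFn x n) s := fun β =>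
    LSeriesSummable_of_eventually_zero ⌈2 * bigT D ^ 2⌉₊ (fun n hn => by
      rw [nN_eq_zero_of_le D β (le_trans (Nat.le_ceil _) (by exact_mod_cast hn)), zero_mul]) s
  have e : (fun m => nuStar c' χ m * psiFn x m)
      = ((((fun n => MeanSquareMajorant.kappa₂ (b1 c' D) n * psiFn x n) ⍟
          (fun n => bcoef D n * χ (n : ZMod D) * psiFn x n)) ⍟
          (fun n => trunc (D ^ 4) (ups χ) n * psiFn x n)) ⍟
          (fun n => nN D (beta2 c' D) n * psiFn x n)) ⍟
          (fun n => nN D (beta3 c' D) n * psiFn x n) := by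
    unfold nuStar
    rw [convolution_mul_psiFn, convolution_mul_psiFn, convolution_mul_psiFn, convolution_mul_psiFn]
  rw [e]
  exact (((h1.convolution h2).convolution h3).convolution (h4 _)).convolution (h4 _)

omit [NeZero D] in
/-- `ν*(0) = 0` (a Dirichlet convolution vanishes at `0`). [cite: Zhang2022LandauSiegel, §17 p. 96] -/
theorem nuStar_zero : nuStar c' χ 0 = 0 := by simp [nuStar]

omit [NeZero D] in
/-- `Σ_m ν*(m)ψ(m)m^{−s}` (t6's right side of `Z22:§17.u004`) is the `LSeries` of `ν*·ψ`. [folklore] -/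
private theorem tsum_nuStar_psi_eq_LSeries (x : Chr D) (s : ℂ) :
    ∑' m : ℕ, nuStar c' χ m * x.ψ (m : ZMod x.p) * (m : ℂ) ^ (-s)
      = LSeries (fun m => nuStar c' χ m * psiFn x m) s := by
  refine tsum_congr fun m => ?_
  rcases eq_or_ne m 0 with rfl | hm
  · simp [nuStar_zero, LSeries.term]
  · rw [LSeries.term_of_ne_zero hm, psiFn, div_eq_mul_inv, Complex.cpow_neg]

/-! ## The integrand on `σ > 1` and the per-character term-by-term step -/

/-- **The integrand of `Φ₃⁺(p)` on `σ > 1`**: `𝔨₃(s,ψ)ω(s) = (Σ_m ν*(m)ψ(m)m^{−s})·(Σ_{n≤D⁴} ν(n)ψ̄(n)n^{s−1})·ω(s)`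
(`Z22:§17.u004` = t6's `step17_u004_holds`, and `F(1−s,ψ̄) = Σ_{n≤D⁴}ν(n)ψ̄(n)n^{−(1−s)}`).
[cite: Zhang2022LandauSiegel, §17 p. 96] -/
theorem kfrak3_mul_omega_eq (x : Chr D) {s : ℂ} (hs : 1 < s.re) :
    kfrak3 c' χ x s * omegaW D s
      = LSeries (fun m => nuStar c' χ m * psiFn x m) s *
          (∑ n ∈ Finset.Icc 1 (D ^ 4), (nu χ n * conj (x.ψ (n : ZMod x.p))) * (n : ℂ) ^ (s - 1)) *
          SmoothWeight.omega (ell2 D) (t0 D) s := by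
  have h004 := step17_u004_holds c' χ x s hs
  rw [kfrak3, h004, tsum_nuStar_psi_eq_LSeries, FpolyBar, omegaW]
  congr 2
  refine Finset.sum_congr rfl fun n _ => ?_
  rw [neg_sub]

/-- The majorant of one term of the double sum: for `m, n ≥ 1`,
`|a(m)m^{−s₀}·b(n)n^{s₀−1}·e^{−𝓛₂²log²(n/m)}| ≤ ‖term a (3/2) m‖·|b(n)|√n·e^{1/(4𝓛₂²)}`.
[cite: Zhang2022LandauSiegel, §17 p. 96 ("By trivial estimation")] -/
theorem norm_T_le {L₂ : ℝ} (hL : 0 < L₂) (t₀ : ℝ) (a b : ℕ → ℂ) {m n : ℕ} (hm : m ≠ 0) (hn : n ≠ 0) :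
    ‖LSeries.term a (SmoothWeight.s0 t₀) m * (b n * (n : ℂ) ^ (SmoothWeight.s0 t₀ - 1)) *
        cexp (-(L₂ : ℂ) ^ 2 * (Real.log ((n : ℝ) / m) : ℂ) ^ 2)‖
      ≤ ‖LSeries.term a (3 / 2 : ℂ) m‖ * (‖b n‖ * Real.sqrt n) * Real.exp (1 / (4 * L₂ ^ 2)) := by
  have hm' : (0 : ℝ) < m := Nat.cast_pos.mpr (Nat.pos_of_ne_zero hm)
  rw [SmoothWeight.norm_term_mul_eq t₀ a b hm hn, LSeries.norm_term_eq, if_neg hm,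
    show (3 / 2 : ℂ).re = (3 / 2 : ℝ) by norm_num, Real.sqrt_eq_rpow]
  have h1 := SmoothWeight.rpow_mul_rpow_mul_exp_le hL hm hn
  have hab : 0 ≤ ‖a m‖ * ‖b n‖ := mul_nonneg (norm_nonneg _) (norm_nonneg _)
  calc ‖a m‖ * (m : ℝ) ^ (-(1 / 2 : ℝ)) * (‖b n‖ * (n : ℝ) ^ (-(1 / 2 : ℝ))) *
        Real.exp (-(L₂ ^ 2 * Real.log ((n : ℝ) / m) ^ 2))
      = ‖a m‖ * ‖b n‖ * ((m : ℝ) ^ (-(1 / 2 : ℝ)) * (n : ℝ) ^ (-(1 / 2 : ℝ)) *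
          Real.exp (-(L₂ ^ 2 * Real.log ((n : ℝ) / m) ^ 2))) := by ring
    _ ≤ ‖a m‖ * ‖b n‖ * ((m : ℝ) ^ (-(3 / 2 : ℝ)) * (n : ℝ) ^ (1 / 2 : ℝ) *
          Real.exp (1 / (4 * L₂ ^ 2))) := mul_le_mul_of_nonneg_left h1 hab
    _ = ‖a m‖ / (m : ℝ) ^ (3 / 2 : ℝ) * (‖b n‖ * (n : ℝ) ^ (1 / 2 : ℝ)) *
          Real.exp (1 / (4 * L₂ ^ 2)) := by
        rw [Real.rpow_neg hm'.le, div_eq_mul_inv]; ring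

/-- Summability in `m` of `Σ_{n∈S} a(m)m^{−s₀}b(n)n^{s₀−1}e^{−𝓛₂²log²(n/m)}·c(m,n)` for any bounded
weights `c` (`|c| ≤ K`) and `0 ∉ S`, given `Σ|a(m)|m^{−3/2} < ∞` — the absolute convergence behind
"integrating term by term" / "by trivial estimation" on `σ = 3/2`.
[cite: Zhang2022LandauSiegel, §17 p. 96 (before (17.3))] -/
theorem summable_sum_T_mul {L₂ : ℝ} (hL : 0 < L₂) (t₀ : ℝ) {a : ℕ → ℂ}
    (ha : LSeriesSummable a (3 / 2 : ℂ)) (b : ℕ → ℂ) {S : Finset ℕ} (hS : 0 ∉ S) (c : ℕ → ℕ → ℂ)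
    {K : ℝ} (hc : ∀ m n, ‖c m n‖ ≤ K) :
    Summable fun m : ℕ => ∑ n ∈ S, LSeries.term a (SmoothWeight.s0 t₀) m *
      (b n * (n : ℂ) ^ (SmoothWeight.s0 t₀ - 1)) *
      cexp (-(L₂ : ℂ) ^ 2 * (Real.log ((n : ℝ) / m) : ℂ) ^ 2) * c m n := by
  refine summable_sum fun n hn => ?_
  have hn0 : n ≠ 0 := fun h => hS (h ▸ hn)
  have hK : 0 ≤ K := le_trans (norm_nonneg _) (hc 0 0)
  have hmaj : Summable fun m : ℕ => ‖LSeries.term a (3 / 2 : ℂ) m‖ *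
      (‖b n‖ * Real.sqrt n) * Real.exp (1 / (4 * L₂ ^ 2)) * K :=
    (((summable_norm_iff.mpr ha).mul_right _).mul_right _).mul_right _
  refine Summable.of_norm_bounded hmaj fun m => ?_
  rcases eq_or_ne m 0 with rfl | hm
  · simp [LSeries.term_zero]
  rw [norm_mul]
  exact mul_le_mul (norm_T_le hL t₀ a b hm hn0) (hc m n) (norm_nonneg _) (by positivity)

/-- **Term by term, one character** (§17 p. 96): for `ψ ∈ Ψ` of modulus `p` and `D ≥ 2`, the
segment integral `(1/2πi)∫_{𝔍(1)}𝔨₃(s,ψ)ω(s)ds` equals the double sum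
`Σ_mΣ_{n≤D⁴} ν*(m)ψ(m)m^{−s₀}·ν(n)ψ̄(n)n^{s₀−1}·e^{−𝓛₂²log²(n/m)}` up to an error
`≤ (Σ_m|ν*(m)ψ(m)|m^{−3/2})(Σ_{n≤D⁴}|ν(n)ψ̄(n)|√n)e^{(1−𝓛₁²)/(4𝓛₂²)}`.
[cite: Zhang2022LandauSiegel, §17 p. 96 (before (17.3))] -/
theorem norm_segInt_kfrak3_sub_tsum_le (hD : 2 ≤ D) (x : Chr D) :
    ‖Lemma81.segInt (t0 D) (ell1 D) 1 (fun s => kfrak3 c' χ x s * omegaW D s) -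
        ∑' m : ℕ, ∑ n ∈ Finset.Icc 1 (D ^ 4),
          LSeries.term (fun m => nuStar c' χ m * psiFn x m) (SmoothWeight.s0 (t0 D)) m *
            ((nu χ n * conj (x.ψ (n : ZMod x.p))) * (n : ℂ) ^ (SmoothWeight.s0 (t0 D) - 1)) *
            cexp (-(ell2 D : ℂ) ^ 2 * (Real.log ((n : ℝ) / m) : ℂ) ^ 2)‖
      ≤ (∑' m : ℕ, ‖LSeries.term (fun m => nuStar c' χ m * psiFn x m) (3 / 2 : ℂ) m‖) *
          (∑ n ∈ Finset.Icc 1 (D ^ 4), ‖nu χ n * conj (x.ψ (n : ZMod x.p))‖ * Real.sqrt n) *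
          Real.exp ((1 - ell1 D ^ 2) / (4 * ell2 D ^ 2)) := by
  have hL : 0 < ell2 D := pow_pos (Real.log_pos (by exact_mod_cast hD)) _
  have hL₁ : 0 ≤ ell1 D := pow_nonneg (Real.log_natCast_nonneg D) _
  have hS : (0 : ℕ) ∉ Finset.Icc 1 (D ^ 4) := by simp
  set a : ℕ → ℂ := fun m => nuStar c' χ m * psiFn x m with ha_def
  set b : ℕ → ℂ := fun n => nu χ n * conj (x.ψ (n : ZMod x.p)) with hb_def
  have ha : LSeriesSummable a (((1 : ℝ) + 1 / 2 : ℝ) : ℂ) :=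
    LSeriesSummable_nuStar_psi c' χ x (by rw [Complex.ofReal_re]; norm_num)
  -- the integrand along the line through `𝔍(1)` is the `SmoothWeightMellin` integrand
  have hG : ∀ v : ℝ, kfrak3 c' χ x (((1 : ℝ) : ℂ) + SmoothWeight.s0 (t0 D) + v * I) *
        omegaW D (((1 : ℝ) : ℂ) + SmoothWeight.s0 (t0 D) + v * I)
      = LSeries a (((1 : ℝ) : ℂ) + SmoothWeight.s0 (t0 D) + v * I) *
          (∑ n ∈ Finset.Icc 1 (D ^ 4), b n *
            (n : ℂ) ^ ((((1 : ℝ) : ℂ) + SmoothWeight.s0 (t0 D) + v * I) - 1)) *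
          SmoothWeight.omega (ell2 D) (t0 D) (((1 : ℝ) : ℂ) + SmoothWeight.s0 (t0 D) + v * I) := by
    intro v
    refine kfrak3_mul_omega_eq c' χ x ?_
    rw [SmoothWeight.linePoint_re]; norm_num
  -- segment and line for the original integrand = those of the rewritten one
  have hseg : Lemma81.segInt (t0 D) (ell1 D) 1 (fun s => kfrak3 c' χ x s * omegaW D s)
      = Lemma81.segInt (t0 D) (ell1 D) ((1 : ℝ) : ℂ) (fun s => LSeries a s *
          (∑ n ∈ Finset.Icc 1 (D ^ 4), b n * (n : ℂ) ^ (s - 1)) *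
          SmoothWeight.omega (ell2 D) (t0 D) s) := by
    rw [Lemma81.segInt_def, Lemma81.segInt_def, Complex.ofReal_one]
    congr 1
    refine intervalIntegral.integral_congr fun v _ => ?_
    have := hG v
    rw [Complex.ofReal_one] at this
    exact this
  have htail := SmoothWeight.norm_lineIntegral_sub_segInt_le hL (t0 D) 1 ha b hS hL₁
  have hmain := SmoothWeight.integral_LSeries_mul_sum_mul_omega hL (t0 D) 1 ha b hS
  rw [hseg, ← hmain, norm_sub_rev]
  refine htail.trans (le_of_eq ?_)
  rw [show ((1 : ℝ) + 1 / 2 - 1 : ℝ) = 1 / 2 by norm_num,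
    show (((1 : ℝ) + 1 / 2 : ℝ) : ℂ) = (3 / 2 : ℂ) by push_cast; norm_num, one_pow]
  congr 2
  refine Finset.sum_congr rfl fun n _ => ?_
  rw [Real.sqrt_eq_rpow]

end Literature.NumberTheory.LFunctions.Zhang2022.Phi3TermByTerm
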